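import Literature.NumberTheory.Automorphic.ArchRankinSelbergTestVector
import Literature.NumberTheory.Automorphic.ArchPolyGaussianDecomposition
import Literature.NumberTheory.Automorphic.MixedSpaceUnitsIntegration
import Literature.NumberTheory.Automorphic.TateLocalZetaArchimedean
import Literature.NumberTheory.Automorphic.HilbertRepSchur
import Literature.Analysis.Complex.UnitaryCharacterParameters
import Mathlib.Topology.Algebra.MvPolynomial
import Mathlib.Analysis.SpecialFunctions.JapaneseBracket
import HarnessLib

/-!
# Humphries–Jo's archimedean test vector theorem in rank one: Tate's computation

Topic `NumberTheory/Automorphic`; namespace `Literature.NumberTheory.Automorphic`. Proof file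
(theorems only) under the named fact `HumphriesJo2024_archRankinSelberg_testVector`
(`ArchRankinSelbergTestVector`; Humphries–Jo (2024), Thm. 1.1: archimedean test vectors for the
`GL_n × GL_n` Rankin–Selberg integral). Its rank-one case is Tate's archimedean local computation
(Tate (1967), §2.5; for `n = 1` the Rankin–Selberg integral `Ψ(s; W, W', Φ)` is the local zeta
integral `∫_{K_∞ˣ} ω ω̄'(y) Φ(y) N(y)^s d^×y` of the product character), and is PROVED here:

* `exists_character_of_glOne` — **Schur**: an irreducible unitary strongly continuous Hilbert
  representation of the commutative group `GL_1(K_∞)` is a continuous unitary character `ω`;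
* `exists_isArchPolyGaussian_tate` — Tate's test functions
  `Φ_∞ = ∏_{w real} x_w^{ε_w} e^{-πx_w²} ∏_{w complex} p_{k_w}(z_w) e^{-π|z_w|²}` (`p_k(z) = z̄^k`, `k ≥ 0`;
  `z^{-k}`, `k < 0`) are polynomial-times-Gaussian (`IsArchPolyGaussian 1 K`), with the explicit
  Gaussian `exp(-π(Σ x_w² + Σ |z_w|²)) = exp(-‖T x‖²)` for a linear isomorphism `T` onto Euclidean space;
* `HumphriesJo2024_archRankinSelberg_testVector_one` (**main**) —
  `HumphriesJo2024_archRankinSelberg_testVector 1 K` for every number field `K`: with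
  `η = ω ω̄' = ∏_w sgn^{ε_w} |·|^{it_w} · ∏_w |·|^{it'_w} (·/|·|)^{k_w}` (the continuous unitary characters
  of `ℝˣ`, `ℂˣ`, `Literature.Analysis.Complex.UnitaryCharacterParameters`) and the test function above,
  the integrand is a radial function of `y₀` (the compact `K_∞ = {±1}^{r₁} × U(1)^{r₂}` drops out),
  the Haar measure of `K_∞ˣ` is `c dx/N(x)` (`MixedSpaceUnitsIntegration`), Fubini over the places,
  and Tate's `∫_ℝ |x|^{s'-1} e^{-πx²} dx = Γ_ℝ(s')` (`TateLocalZetaArchimedean.zeta_real_trivial`),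
  `∫_ℂ (|z|²)^{a-1} e^{-π|z|²} = π^{1-a} Γ(a) = (π/2) 2^a Γ_ℂ(a)` give
  `Ψ_∞(s) = ℓ(e) ℓ'(e')⁻ · vol · c · ∏_w Γ_ℝ(s + it_w + ε_w) ∏_w (π/2) 2^{b_w} 2^s Γ_ℂ(s + b_w)`,
  `b_w = (it'_w + |k_w|)/2`, i.e. `c^s ∏ Γ_ℝ(s + a_j) ∏ Γ_ℂ(s + b_j)` with `c = 2^{r₂}`,
  `re a_j = ε_j ∈ {0,1}`, `re b_j = |k_j|/2 ≥ 0` after normalising `e`; the integrability clause for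
  every polynomial-times-Gaussian from `|q(Lx)| e^{-‖Tx‖²} ≤ C (1+‖x‖)^k e^{-m‖x‖²}` and
  `N(x)^{σ-1} (1+‖x‖)^k e^{-m‖x‖²} ≤ C' (1+‖x‖)^{-dim-1}` (`integrable_one_add_norm`).

This certifies, in the rank where its analytic content is Tate's thesis, that the hypotheses and
normalisations of the named fact (`c^s`, shifts of real part `> -1`, the measures `μA × μK`, the weight
`archTorusWeightC`, `archLastRow`, `IsArchPolyGaussian`) are jointly satisfiable and correctly wired.
Ranks `n ≥ 2` are the archimedean Whittaker theory of Jacquet–Shalika / Stade / Humphries–Jo and are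
NOT proved here.

## References

* P. Humphries, Y. Jo, *Test vectors for archimedean period integrals*, Publ. Mat. 68 (2024),
  Thm. 1.1 [HumphriesJo2024].
* J. Tate, *Fourier analysis in number fields and Hecke's zeta-functions*, in Cassels–Fröhlich (1967),
  Ch. XV, §2.5 (pp. 343–345) [TateThesis1967].
* J. W. Cogdell, *Analytic theory of L-functions for GL_n* (2004), §3.1 item (1) [CogdellAnalyticTheory2004].
-/

noncomputable section

open MeasureTheory Measure NumberField NumberField.InfinitePlace NumberField.mixedEmbedding IsDedekindDomain Set
open scoped MatrixGroups ENNReal NNReal Classical ComplexConjugate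

namespace Literature.NumberTheory.Automorphic

/-! ### `GL_1`: every element is the diagonal matrix of its determinant -/

section GLOne

variable {R : Type*} [CommRing R]

/-- In `GL_1(R)` every element is `diag(det g)`. [folklore] -/
theorem glOne_eq_glDiagonal_det (g : GL (Fin 1) R) :
    g = glDiagonal 1 R (fun _ => Matrix.GeneralLinearGroup.det g) := by
  refine Units.ext (Matrix.ext fun i j => ?_)
  have hi : i = 0 := Subsingleton.elim _ _
  have hj : j = 0 := Subsingleton.elim _ _
  subst hi; subst hj
  rw [coe_glDiagonal, Matrix.diagonal_apply_eq, Matrix.GeneralLinearGroup.val_det_apply,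
    Matrix.det_fin_one]

/-- `GL_1(R)` is commutative.  DUPLICATE (dedup-02556) of the tree's `GL_fin_one_mul_comm`
(`AutomorphicLFunctionsProofs.lean`); kept only as a deprecated alias — the use below is rewired
to the survivor. [folklore] -/
@[deprecated (since := "2026-08-16")]
alias glOne_mul_comm := GL_fin_one_mul_comm

/-- The `(0,0)` entry of `g ∈ GL_1(R)` is `det g`. [folklore] -/
theorem glOne_apply (g : GL (Fin 1) R) (i j : Fin 1) :
    (g : Matrix (Fin 1) (Fin 1) R) i j = (Matrix.GeneralLinearGroup.det g : R) := by
  have hi : i = 0 := Subsingleton.elim _ _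
  have hj : j = 0 := Subsingleton.elim _ _
  subst hi; subst hj
  rw [Matrix.GeneralLinearGroup.val_det_apply, Matrix.det_fin_one]

/-- `det (diag(c)) = c` in `GL_1`. [folklore] -/
theorem det_glDiagonal_one (c : Fin 1 → Rˣ) :
    Matrix.GeneralLinearGroup.det (glDiagonal 1 R c) = c 0 := by
  refine Units.ext ?_
  rw [Matrix.GeneralLinearGroup.val_det_apply, coe_glDiagonal, Matrix.det_diagonal,
    Fin.prod_univ_one]

end GLOne

/-! ### Schur: an irreducible unitary representation of `GL_1(K_∞)` is a unitary character -/

section Character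

variable {K : Type} [Field K] [NumberField K]
variable {hcpt : isCompact_glFiniteIntegralLevel 1 K}
  {E : Type*} [NormedAddCommGroup E] [InnerProductSpace ℂ E] [CompleteSpace E]
  {τ : ContRepresentation ℂ (AutomorphyDatum.gl 1 K hcpt).arch.carrier E}

/-- **Schur's lemma for `GL_1(K_∞)`**: an irreducible unitary strongly continuous representation
`τ` of the commutative group `GL_1(K_∞)` acts through a continuous unitary character `ω`:
`τ(g) v = ω(g) v`, `|ω(g)| = 1`, `ω` multiplicative and continuous. [folklore] -/
theorem exists_character_of_glOne (hτ : τ.IsStronglyContinuous) (hτu : τ.IsUnitary)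
    (hτi : τ.IsTopIrreducible) :
    ∃ ω : GL (Fin 1) (mixedSpace K) →* ℂˣ, Continuous (fun g => (ω g : ℂ)) ∧
      (∀ g, ‖(ω g : ℂ)‖ = 1) ∧ ∀ g (v : E), τ (toArch hcpt g) v = (ω g : ℂ) • v := by
  haveI : Nontrivial E := ((ContRepresentation.isTopIrreducible_iff τ).1 hτi).1
  have key : ∀ g : GL (Fin 1) (mixedSpace K), ∃ c : ℂ, ‖c‖ = 1 ∧ ∀ v : E, τ (toArch hcpt g) v = c • v := by
    intro g
    have hcomm : ∀ h : (AutomorphyDatum.gl 1 K hcpt).arch.carrier, Commute (τ h) (τ (toArch hcpt g)) := by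
      intro h
      change τ h * τ (toArch hcpt g) = τ (toArch hcpt g) * τ h
      rw [← map_mul, ← map_mul]
      congr 1
      exact Subtype.ext (GL_fin_one_mul_comm _ _)
    obtain ⟨c, hc⟩ := hτi.exists_apply_eq_smul_of_commute hτu hcomm
    obtain ⟨v, hv⟩ := exists_ne (0 : E)
    refine ⟨c, ?_, hc⟩
    have h := hτu.norm_map (toArch hcpt g) v
    rw [hc v, _root_.norm_smul] at h
    have hv' : ‖v‖ ≠ 0 := norm_ne_zero_iff.2 hv
    field_simp at h
    linarith [h]
  choose c hc1 hc using key
  have hc0 : ∀ g, c g ≠ 0 := fun g h => by simpa [h] using hc1 g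
  have hmul : ∀ g h, c (g * h) = c g * c h := fun g h => by
    obtain ⟨v, hv⟩ := exists_ne (0 : E)
    have h1 : τ (toArch hcpt (g * h)) v = τ (toArch hcpt g) (τ (toArch hcpt h) v) := by
      rw [show toArch hcpt (g * h) = toArch hcpt g * toArch hcpt h from rfl, map_mul]
      rfl
    rw [hc, hc, hc, smul_smul] at h1
    exact smul_left_injective ℂ hv h1
  have hone : c 1 = 1 := by
    have h := hmul 1 1
    rw [mul_one] at h
    exact (mul_eq_left₀ (hc0 1)).mp h.symm
  let ω : GL (Fin 1) (mixedSpace K) →* ℂˣ :=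
    { toFun := fun g => Units.mk0 (c g) (hc0 g)
      map_one' := Units.ext hone
      map_mul' := fun g h => Units.ext (hmul g h) }
  refine ⟨ω, ?_, fun g => hc1 g, fun g v => hc g v⟩
  -- continuity: `c g = f (τ(g) v)` for a functional `f` with `f v = 1`
  obtain ⟨v, hv⟩ := exists_ne (0 : E)
  obtain ⟨f, -, hf⟩ := exists_dual_vector ℂ v (norm_ne_zero_iff.2 hv)
  have hfv : f v ≠ 0 := by
    rw [hf]
    exact Complex.ofReal_ne_zero.mpr (norm_ne_zero_iff.2 hv)
  have heq : (fun g => (ω g : ℂ)) = fun g => f (τ (toArch hcpt g) v) / f v := by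
    funext g
    change c g = _
    rw [hc, map_smul, smul_eq_mul, mul_div_assoc, div_self hfv, mul_one]
  rw [heq]
  exact ((f.continuous.comp (continuous_apply_toArch hcpt τ hτ v)).div_const _)

end Character

section TestFun

variable (K : Type) [Field K] [NumberField K]

/-- `dim_ℝ (K_∞)^1 = r₁ + 2 r₂ = #(index K)`. [folklore] -/
theorem finrank_fin_one_mixedSpace_eq_card_index :
    Module.finrank ℝ (Fin 1 → mixedSpace K) = Fintype.card (index K) := by
  rw [Module.finrank_pi_fintype ℝ, Fin.sum_univ_one, mixedEmbedding.finrank, Fintype.card_sum,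
    Fintype.card_prod, Fintype.card_fin, ← card_add_two_mul_card_eq_rank, nrRealPlaces, nrComplexPlaces]
  ring

/-- `re z - i · im z = z̄`. [folklore] -/
theorem ofReal_re_sub_I_mul_im (z : ℂ) : (z.re : ℂ) - Complex.I * z.im = conj z :=
  Complex.ext (by simp) (by simp)

/-- `re z + i · im z = z`. [folklore] -/
theorem ofReal_re_add_I_mul_im (z : ℂ) : (z.re : ℂ) + Complex.I * z.im = z :=
  Complex.ext (by simp) (by simp)

/-- **Tate's test functions are polynomial-times-Gaussian.** For parities `ε_w` at the real places
and integers `k_w` at the complex places, the function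
`Φ(z) = ∏_{w real} x_w^{ε_w} e^{-π x_w²} · ∏_{w complex} p_w(z_w) e^{-π |z_w|²}` of `z ∈ K_∞`
(`p_w(z) = z̄^{k_w}` for `k_w ≥ 0`, `z^{-k_w}` for `k_w < 0`; coordinates read through `K_∞ ≃ K ⊗ ℝ`)
is a complex polynomial in the real coordinates times the Gaussian `exp(-‖T x‖²)`,
`‖T x‖² = π (Σ_w x_w² + Σ_w |z_w|²)` (`IsArchPolyGaussian`). Tate (1967), §2.5: the functions
`e^{-πξ²}`, `ξ e^{-πξ²}` (`k` real) and `ξ̄^{|n|} e^{-2π ξξ̄}` (`k` complex, here with `π`).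
[cite: TateThesis1967, §2.5 (pp. 343–344)] [cite: HumphriesJo2024, Prop. 5.2] -/
theorem exists_isArchPolyGaussian_tate (ε : {w : InfinitePlace K // IsReal w} → ℕ)
    (k : {w : InfinitePlace K // IsComplex w} → ℤ) :
    ∃ Φ : (Fin 1 → InfiniteAdeleRing K) → ℂ, IsArchPolyGaussian 1 K Φ ∧
      ∀ z : Fin 1 → InfiniteAdeleRing K,
        Φ z = (∏ w, (((InfiniteAdeleRing.ringEquiv_mixedSpace K (z 0)).1 w : ℝ) : ℂ) ^ (ε w) *
                 (Real.exp (-(Real.pi * ((InfiniteAdeleRing.ringEquiv_mixedSpace K (z 0)).1 w) ^ 2)) : ℂ)) *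
              ∏ w, ((if 0 ≤ k w then (conj ((InfiniteAdeleRing.ringEquiv_mixedSpace K (z 0)).2 w)) ^ (k w).toNat
                      else ((InfiniteAdeleRing.ringEquiv_mixedSpace K (z 0)).2 w) ^ (-(k w)).toNat) *
                 (Real.exp (-(Real.pi * ‖(InfiniteAdeleRing.ringEquiv_mixedSpace K (z 0)).2 w‖ ^ 2)) : ℂ)) := by
  -- the real coordinates of `(K_∞)^1`
  let V := Fin 1 → mixedSpace K
  let ι := index K
  let pr0 : V →L[ℝ] mixedSpace K := ContinuousLinearMap.proj (R := ℝ) (φ := fun _ : Fin 1 => mixedSpace K) 0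
  let coord : ι → (V →L[ℝ] ℝ) := Sum.elim
    (fun w => (ContinuousLinearMap.proj (R := ℝ) (φ := fun _ : {w : InfinitePlace K // IsReal w} => ℝ) w).comp
      ((ContinuousLinearMap.fst ℝ _ _).comp pr0))
    (fun p => ((if p.2 = 0 then Complex.reCLM else Complex.imCLM).comp
      ((ContinuousLinearMap.proj (R := ℝ) (φ := fun _ : {w : InfinitePlace K // IsComplex w} => ℂ) p.1).comp
        ((ContinuousLinearMap.snd ℝ _ _).comp pr0))))
  have hinl : ∀ (w) (x : V), coord (Sum.inl w) x = (x 0).1 w := fun w x => rfl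
  have hinr0 : ∀ (w) (x : V), coord (Sum.inr (w, 0)) x = ((x 0).2 w).re := fun w x => rfl
  have hinr1 : ∀ (w) (x : V), coord (Sum.inr (w, 1)) x = ((x 0).2 w).im := fun w x => rfl
  -- indexing by `Fin N`
  let N := Fintype.card ι
  let eι : ι ≃ Fin N := Fintype.equivFin ι
  let L : Fin N → (V →L[ℝ] ℝ) := fun i => coord (eι.symm i)
  have hL : ∀ (j : ι) (x : V), L (eι j) x = coord j x := fun j x => by
    simp only [L, Equiv.symm_apply_apply]
  -- the polynomial
  let q : MvPolynomial (Fin N) ℂ :=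
    (∏ w, MvPolynomial.X (eι (Sum.inl w)) ^ ε w) *
      ∏ w, (if 0 ≤ k w then
          (MvPolynomial.X (eι (Sum.inr (w, 0))) - MvPolynomial.C Complex.I * MvPolynomial.X (eι (Sum.inr (w, 1)))) ^ (k w).toNat
        else (MvPolynomial.X (eι (Sum.inr (w, 0))) + MvPolynomial.C Complex.I * MvPolynomial.X (eι (Sum.inr (w, 1)))) ^ (-(k w)).toNat)
  have hq : ∀ x : V, MvPolynomial.eval (fun i => ((L i x : ℝ) : ℂ)) q =
      (∏ w, (((x 0).1 w : ℝ) : ℂ) ^ (ε w)) *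
        ∏ w, (if 0 ≤ k w then (conj ((x 0).2 w)) ^ (k w).toNat else ((x 0).2 w) ^ (-(k w)).toNat) := by
    intro x
    simp only [q, map_mul, map_prod, map_pow, MvPolynomial.eval_X, hL, hinl]
    congr 1
    refine Finset.prod_congr rfl fun w _ => ?_
    split_ifs with hk
    · rw [map_pow, map_sub, map_mul, MvPolynomial.eval_C, MvPolynomial.eval_X, MvPolynomial.eval_X, hL, hL,
        hinr0, hinr1, ofReal_re_sub_I_mul_im]
    · rw [map_pow, map_add, map_mul, MvPolynomial.eval_C, MvPolynomial.eval_X, MvPolynomial.eval_X, hL, hL,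
        hinr0, hinr1, ofReal_re_add_I_mul_im]
  -- the linear isomorphism `T`
  let f : V →ₗ[ℝ] EuclideanSpace ℝ ι :=
    (WithLp.linearEquiv 2 ℝ (ι → ℝ)).symm.toLinearMap ∘ₗ LinearMap.pi (fun i => Real.sqrt Real.pi • (coord i).toLinearMap)
  have hf : ∀ (x : V) (i : ι), f x i = Real.sqrt Real.pi * coord i x := fun x i => rfl
  have hfinj : Function.Injective f := by
    intro x y hxy
    have h : ∀ i, coord i x = coord i y := fun i => by
      have h1 := congrArg (fun v : EuclideanSpace ℝ ι => v i) hxy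
      simp only [hf] at h1
      exact mul_left_cancel₀ (Real.sqrt_ne_zero'.mpr Real.pi_pos) h1
    funext j
    have hj : j = 0 := Subsingleton.elim _ _
    subst hj
    refine Prod.ext (funext fun w => ?_) (funext fun w => Complex.ext ?_ ?_)
    · simpa only [hinl] using h (Sum.inl w)
    · simpa only [hinr0] using h (Sum.inr (w, 0))
    · simpa only [hinr1] using h (Sum.inr (w, 1))
  have hdim : Module.finrank ℝ V = Module.finrank ℝ (EuclideanSpace ℝ ι) := by
    rw [finrank_euclideanSpace]
    exact finrank_fin_one_mixedSpace_eq_card_index K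
  let fe : V ≃ₗ[ℝ] EuclideanSpace ℝ ι := f.linearEquivOfInjective hfinj hdim
  have hfe : ∀ x, fe x = f x := fun x => rfl
  have hcard : Fintype.card ι = Module.finrank ℝ V := (finrank_fin_one_mixedSpace_eq_card_index K).symm
  let eFin : ι ≃ Fin (Module.finrank ℝ V) := Fintype.equivFinOfCardEq hcard
  let T : V ≃L[ℝ] EuclideanSpace ℝ (Fin (Module.finrank ℝ V)) :=
    fe.toContinuousLinearEquiv.trans (LinearIsometryEquiv.piLpCongrLeft 2 ℝ ℝ eFin).toContinuousLinearEquiv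
  have hT : ∀ x : V, ‖T x‖ ^ 2 = Real.pi * ((∑ w, ((x 0).1 w) ^ 2) + ∑ w, ‖(x 0).2 w‖ ^ 2) := by
    intro x
    have h1 : ‖T x‖ = ‖f x‖ := by
      change ‖(LinearIsometryEquiv.piLpCongrLeft 2 ℝ ℝ eFin) (fe.toContinuousLinearEquiv x)‖ = _
      rw [LinearIsometryEquiv.norm_map]
      rfl
    rw [h1, EuclideanSpace.real_norm_sq_eq, Fintype.sum_sum_type, Fintype.sum_prod_type]
    have key : ∀ w : {w : InfinitePlace K // IsComplex w},
        (Real.sqrt Real.pi * ((x 0).2 w).re) ^ 2 + (Real.sqrt Real.pi * ((x 0).2 w).im) ^ 2 =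
          Real.pi * ‖(x 0).2 w‖ ^ 2 := fun w => by
      rw [mul_pow, mul_pow, Real.sq_sqrt Real.pi_pos.le, Complex.sq_norm, Complex.normSq_apply]
      ring
    have key' : ∀ w : {w : InfinitePlace K // IsReal w},
        (Real.sqrt Real.pi * (x 0).1 w) ^ 2 = Real.pi * ((x 0).1 w) ^ 2 := fun w => by
      rw [mul_pow, Real.sq_sqrt Real.pi_pos.le]
    simp only [hf, hinl, Fin.sum_univ_two, hinr0, hinr1, key, key', ← Finset.mul_sum, mul_add]
  -- the test function
  let xz : (Fin 1 → InfiniteAdeleRing K) → V := fun z j => InfiniteAdeleRing.ringEquiv_mixedSpace K (z j)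
  refine ⟨fun z => MvPolynomial.eval (fun i => ((L i (xz z) : ℝ) : ℂ)) q * ((Real.exp (-‖T (xz z)‖ ^ 2) : ℝ) : ℂ),
    ⟨N, L, q, T, fun z => rfl⟩, fun z => ?_⟩
  have hx0 : xz z 0 = InfiniteAdeleRing.ringEquiv_mixedSpace K (z 0) := rfl
  dsimp only
  rw [hq, hT, hx0, mul_add, neg_add, Real.exp_add, Finset.mul_sum, Finset.mul_sum, ← Finset.sum_neg_distrib,
    ← Finset.sum_neg_distrib, Real.exp_sum, Real.exp_sum, Complex.ofReal_mul, Complex.ofReal_prod,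
    Complex.ofReal_prod, mul_mul_mul_comm, ← Finset.prod_mul_distrib, ← Finset.prod_mul_distrib]

end TestFun

/-! ### `GL_1(K_∞)`: last row, weight, determinant of `diag(y) k`, the compact torus -/

section GLOneArch

variable {K : Type} [Field K] [NumberField K]

omit [NumberField K] in
/-- The last row of `g ∈ GL_1(K_∞)` is its entry `det g`. [folklore] -/
theorem archLastRow_glOne (g : GL (Fin 1) (mixedSpace K)) :
    archLastRow 1 K g = fun _ => (InfiniteAdeleRing.ringEquiv_mixedSpace K).symm
      ((Matrix.GeneralLinearGroup.det g : (mixedSpace K)ˣ) : mixedSpace K) := by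
  funext j
  unfold archLastRow
  congr 1
  rw [Matrix.vecMul, dotProduct, Fin.sum_univ_one, if_pos (by simp), one_mul, glOne_apply]

/-- The archimedean torus weight of `GL_1` is `N(y)^s`. [folklore] -/
theorem archTorusWeightC_one (s : ℂ) (y : Fin 1 → (mixedSpace K)ˣ) :
    archTorusWeightC 1 K s y = ((mixedEmbedding.norm ((y 0 : (mixedSpace K)ˣ) : mixedSpace K) : ℝ) : ℂ) ^ s := by
  unfold archTorusWeightC
  rw [Fin.prod_univ_one]
  congr 1
  simp

omit [NumberField K] in
/-- `det (diag(y) k) = y₀ det k` in `GL_1`. [folklore] -/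
theorem det_glDiagonal_one_mul (y : Fin 1 → (mixedSpace K)ˣ) (k : GL (Fin 1) (mixedSpace K)) :
    Matrix.GeneralLinearGroup.det (glDiagonal 1 (mixedSpace K) y * k) = y 0 * Matrix.GeneralLinearGroup.det k := by
  rw [map_mul, det_glDiagonal_one]

/-- An element of `K_∞ = O(1)^{r₁} × U(1)^{r₂} ≤ GL_1(K_∞)` has coordinates of modulus `1`. [folklore] -/
theorem abs_fst_det_eq_one_of_mem_Kinf (k : ↥(Kinf 1 K)) (w : {w : InfinitePlace K // IsReal w}) :
    |((Matrix.GeneralLinearGroup.det (k : GL (Fin 1) (mixedSpace K)) : (mixedSpace K)ˣ) : mixedSpace K).1 w| = 1 := by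
  have hk : (k : GL (Fin 1) (mixedSpace K)) ∈ unitarySubgroupGL (mixedSpace K) (Fin 1) := by
    rw [← Kinf_eq_unitarySubgroupGL]; exact k.2
  rw [mem_unitarySubgroupGL_iff] at hk
  have h00 := congrFun (congrFun hk 0) 0
  rw [Matrix.mul_apply, Fin.sum_univ_one, Matrix.star_apply, glOne_apply, Matrix.one_apply_eq] at h00
  have h1 := congrFun (congrArg Prod.fst h00) w
  simp only [Prod.fst_mul, Pi.mul_apply, Prod.fst_star, star_trivial, Prod.fst_one, Pi.one_apply] at h1
  rcases mul_self_eq_one_iff.mp h1 with h | h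
  · rw [h, abs_one]
  · rw [h, abs_neg, abs_one]

/-- An element of `K_∞ = O(1)^{r₁} × U(1)^{r₂} ≤ GL_1(K_∞)` has coordinates of modulus `1`. [folklore] -/
theorem norm_snd_det_eq_one_of_mem_Kinf (k : ↥(Kinf 1 K)) (w : {w : InfinitePlace K // IsComplex w}) :
    ‖((Matrix.GeneralLinearGroup.det (k : GL (Fin 1) (mixedSpace K)) : (mixedSpace K)ˣ) : mixedSpace K).2 w‖ = 1 := by
  have hk : (k : GL (Fin 1) (mixedSpace K)) ∈ unitarySubgroupGL (mixedSpace K) (Fin 1) := by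
    rw [← Kinf_eq_unitarySubgroupGL]; exact k.2
  rw [mem_unitarySubgroupGL_iff] at hk
  have h00 := congrFun (congrFun hk 0) 0
  rw [Matrix.mul_apply, Fin.sum_univ_one, Matrix.star_apply, glOne_apply, Matrix.one_apply_eq] at h00
  have h1 := congrFun (congrArg Prod.snd h00) w
  simp only [Prod.snd_mul, Pi.mul_apply, Prod.snd_star, Pi.star_apply, Complex.star_def, Prod.snd_one,
    Pi.one_apply, Complex.conj_mul'] at h1
  have h2 : ‖((Matrix.GeneralLinearGroup.det (k : GL (Fin 1) (mixedSpace K)) : (mixedSpace K)ˣ) : mixedSpace K).2 w‖ ^ 2 = 1 := by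
    exact_mod_cast h1
  nlinarith [norm_nonneg (((Matrix.GeneralLinearGroup.det (k : GL (Fin 1) (mixedSpace K)) : (mixedSpace K)ˣ) : mixedSpace K).2 w)]

/-- The sup norm of `K_∞` is unchanged by a coordinatewise unimodular factor. [folklore] -/
theorem norm_mul_eq_of_unimodular {x u : mixedSpace K} (hu1 : ∀ w, |u.1 w| = 1) (hu2 : ∀ w, ‖u.2 w‖ = 1) :
    ‖x * u‖ = ‖x‖ := by
  simp only [Prod.norm_def, Pi.norm_def, Prod.fst_mul, Prod.snd_mul, Pi.mul_apply, nnnorm_mul]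
  congr 2
  · refine Finset.sup_congr rfl fun w _ => ?_
    have : ‖u.1 w‖₊ = 1 := by rw [← NNReal.coe_inj, coe_nnnorm, Real.norm_eq_abs, hu1 w, NNReal.coe_one]
    rw [this, mul_one]
  · refine Finset.sup_congr rfl fun w _ => ?_
    have : ‖u.2 w‖₊ = 1 := by rw [← NNReal.coe_inj, coe_nnnorm, hu2 w, NNReal.coe_one]
    rw [this, mul_one]

end GLOneArch

/-! ### Scalar lemmas -/

section Scalar

/-- `(∏ aᵢ)^z = ∏ aᵢ^z` for non-negative reals `aᵢ` and complex `z`. [folklore] -/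
theorem ofReal_prod_cpow_of_nonneg {ι : Type*} (s : Finset ι) (f : ι → ℝ) (hf : ∀ i, 0 ≤ f i) (z : ℂ) :
    (((∏ i ∈ s, f i : ℝ)) : ℂ) ^ z = ∏ i ∈ s, ((f i : ℝ) : ℂ) ^ z := by
  classical
  induction s using Finset.induction_on with
  | empty => simp
  | insert a s ha ih =>
    rw [Finset.prod_insert ha, Finset.prod_insert ha, ← ih, ← Complex.mul_cpow_ofReal_nonneg (hf a)
      (Finset.prod_nonneg fun i _ => hf i), Complex.ofReal_mul]

/-- `(2^n)^s = (2^s)^n` for the positive real base `2`. [folklore] -/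
theorem ofReal_two_pow_cpow (n : ℕ) (s : ℂ) : (((2 : ℝ) ^ n : ℝ) : ℂ) ^ s = ((2 : ℂ) ^ s) ^ n := by
  have h := ofReal_prod_cpow_of_nonneg (Finset.univ : Finset (Fin n)) (fun _ => (2 : ℝ)) (fun _ => zero_le_two) s
  rw [Finset.prod_const, Finset.card_univ, Fintype.card_fin] at h
  rw [h, Finset.prod_const, Finset.card_univ, Fintype.card_fin]
  push_cast
  ring

/-- **Real coordinate**: `sgn(x)^ε x^ε = |x|^ε` (`x ≠ 0`), so the character `sgn^ε |·|^{it}`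
against Tate's `x^ε e^{-πx²}` is radial. [folklore] -/
theorem sign_pow_mul_pow_eq_abs_pow {x : ℝ} (hx : x ≠ 0) (ε : ℕ) :
    (SignType.sign x : ℂ) ^ ε * (x : ℂ) ^ ε = (((|x| : ℝ)) : ℂ) ^ ε := by
  rw [← mul_pow]
  congr 1
  rcases lt_or_gt_of_ne hx with h | h
  · rw [_root_.sign_neg h, abs_of_neg h, SignType.coe_neg_one]; push_cast; ring
  · rw [_root_.sign_pos h, abs_of_pos h, SignType.coe_one, one_mul]

/-- **Complex coordinate**: `(z/|z|)^k p_k(z) = |z|^{|k|}` (`z ≠ 0`) for Tate's `p_k(z) = z̄^k` (`k ≥ 0`),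
`z^{-k}` (`k < 0`). [folklore] -/
theorem div_norm_zpow_mul_tatePoly {z : ℂ} (hz : z ≠ 0) (k : ℤ) :
    (z / (‖z‖ : ℂ)) ^ k * (if 0 ≤ k then (conj z) ^ k.toNat else z ^ (-k).toNat) =
      (((‖z‖ ^ k.natAbs : ℝ)) : ℂ) := by
  have hn0 : (‖z‖ : ℂ) ≠ 0 := Complex.ofReal_ne_zero.mpr (norm_ne_zero_iff.mpr hz)
  split_ifs with hk
  · have hkn : k = (k.toNat : ℤ) := (Int.toNat_of_nonneg hk).symm
    have hab : k.natAbs = k.toNat := by omega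
    rw [hab, hkn, zpow_natCast, Int.toNat_natCast, mul_comm]
    exact TateArchimedean.conj_pow_mul_div_norm_pow hz _
  · push Not at hk
    have hkn : k = -((-k).toNat : ℤ) := by omega
    have hab : k.natAbs = (-k).toNat := by omega
    have hzk : (z / (‖z‖ : ℂ)) ^ k = ((‖z‖ : ℂ) / z) ^ (-k).toNat := by
      conv_lhs => rw [hkn]
      rw [zpow_neg, zpow_natCast, ← inv_pow, inv_div]
    rw [hab, hzk, ← mul_pow, div_mul_cancel₀ _ hz, Complex.ofReal_pow]

/-- `(1 + r)^P e^{-m r²} ≤ e^{P²/(4m)}` for `P, r ≥ 0`, `m > 0`. [folklore] -/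
theorem one_add_rpow_mul_exp_neg_mul_sq_le {P m r : ℝ} (hP : 0 ≤ P) (hm : 0 < m) (hr : 0 ≤ r) :
    (1 + r) ^ P * Real.exp (-m * r ^ 2) ≤ Real.exp (P ^ 2 / (4 * m)) := by
  have h1 : (1 + r) ^ P ≤ Real.exp (P * r) := by
    calc (1 + r) ^ P ≤ (Real.exp r) ^ P :=
          Real.rpow_le_rpow (by linarith) (by linarith [Real.add_one_le_exp r]) hP
      _ = Real.exp (P * r) := by rw [← Real.exp_mul, mul_comm]
  calc (1 + r) ^ P * Real.exp (-m * r ^ 2) ≤ Real.exp (P * r) * Real.exp (-m * r ^ 2) :=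
        mul_le_mul_of_nonneg_right h1 (Real.exp_pos _).le
    _ = Real.exp (P * r + -m * r ^ 2) := by rw [Real.exp_add]
    _ ≤ Real.exp (P ^ 2 / (4 * m)) := by
        refine Real.exp_le_exp.mpr ?_
        have h : P * r + -m * r ^ 2 = P ^ 2 / (4 * m) - m * (r - P / (2 * m)) ^ 2 := by
          field_simp
          ring
        rw [h]
        nlinarith [sq_nonneg (r - P / (2 * m))]

end Scalar

/-! ### Bounds for polynomial-times-Gaussians on `(K_∞)^1` -/

section PolyGaussBound

variable {K : Type} [Field K] [NumberField K]

/-- **Gaussian bound for a polynomial times a Gaussian**: `|q(L x) e^{-‖T x‖²}| ≤ C (1 + ‖x‖)^k e^{-m ‖x‖²}`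
with `C ≥ 0`, `m > 0` (temperate growth of polynomials; `‖x‖ ≤ ‖T⁻¹‖ ‖T x‖`). [folklore] -/
theorem exists_polyGaussian_bound {N : ℕ} (L : Fin N → ((Fin 1 → mixedSpace K) →L[ℝ] ℝ))
    (q : MvPolynomial (Fin N) ℂ)
    (T : (Fin 1 → mixedSpace K) ≃L[ℝ] EuclideanSpace ℝ (Fin (Module.finrank ℝ (Fin 1 → mixedSpace K)))) :
    ∃ (C : ℝ) (k : ℕ) (m : ℝ), 0 ≤ C ∧ 0 < m ∧ ∀ x : Fin 1 → mixedSpace K,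
      ‖MvPolynomial.eval (fun i => ((L i x : ℝ) : ℂ)) q * ((Real.exp (-‖T x‖ ^ 2) : ℝ) : ℂ)‖ ≤
        C * (1 + ‖x‖) ^ k * Real.exp (-m * ‖x‖ ^ 2) := by
  obtain ⟨k, C, hC0, hC⟩ := exists_norm_le_of_hasTemperateGrowth (hasTemperateGrowth_eval_clm L q)
  -- `‖x‖ ≤ ‖T⁻¹‖ ‖T x‖`
  set A : ℝ := ‖(T.symm : EuclideanSpace ℝ (Fin (Module.finrank ℝ (Fin 1 → mixedSpace K))) →L[ℝ] (Fin 1 → mixedSpace K))‖ with hA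
  have hAx : ∀ x, ‖x‖ ≤ A * ‖T x‖ := fun x => by
    have h := (T.symm : _ →L[ℝ] (Fin 1 → mixedSpace K)).le_opNorm (T x)
    rwa [ContinuousLinearEquiv.coe_coe, ContinuousLinearEquiv.symm_apply_apply] at h
  set m : ℝ := 1 / (A + 1) ^ 2 with hm
  have hA0 : 0 ≤ A := norm_nonneg _
  have hmpos : 0 < m := by rw [hm]; positivity
  refine ⟨C, k, m, hC0, hmpos, fun x => ?_⟩
  rw [norm_mul, Complex.norm_real, Real.norm_eq_abs, abs_of_pos (Real.exp_pos _)]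
  refine mul_le_mul (hC x) ?_ (Real.exp_pos _).le (by positivity)
  refine Real.exp_le_exp.mpr ?_
  -- `m ‖x‖² ≤ ‖T x‖²`
  have h1 : ‖x‖ ≤ (A + 1) * ‖T x‖ := (hAx x).trans (by nlinarith [norm_nonneg (T x)])
  have h2 : ‖x‖ ^ 2 ≤ (A + 1) ^ 2 * ‖T x‖ ^ 2 := by
    rw [← mul_pow]; exact pow_le_pow_left₀ (norm_nonneg _) h1 2
  have h3 : m * ‖x‖ ^ 2 ≤ ‖T x‖ ^ 2 := by
    rw [hm, one_div, inv_mul_le_iff₀ (by positivity)]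
    exact h2
  linarith

/-- `N(x) ≤ (1 + ‖x‖)^{[K:ℚ]}` on `K_∞`. [folklore] -/
theorem mixedEmbedding_norm_le_one_add_norm_pow (x : mixedSpace K) :
    mixedEmbedding.norm x ≤ (1 + ‖x‖) ^ Module.finrank ℚ K := by
  rw [mixedEmbedding.norm_apply, ← sum_mult_eq, ← Finset.prod_pow_eq_pow_sum]
  refine Finset.prod_le_prod (fun w _ => pow_nonneg (normAtPlace_nonneg _ _) _) fun w _ => ?_
  refine pow_le_pow_left₀ (normAtPlace_nonneg _ _) ?_ _
  have h : normAtPlace w x ≤ ‖x‖ := by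
    rw [norm_eq_sup'_normAtPlace]
    exact Finset.le_sup' (fun w => normAtPlace w x) (Finset.mem_univ w)
  linarith [norm_nonneg x]

end PolyGaussBound

/-! ### The theorem -/

section Main

variable (K : Type) [Field K] [NumberField K]

attribute [local instance] Literature.MeasureTheory.Group.Units.borelSpace_of_isOpenEmbedding
  Literature.MeasureTheory.Group.hasSummableGeomSeries_of_finiteDimensional

set_option maxHeartbeats 6000000 in
/-- **Humphries–Jo's archimedean test vector theorem in rank `n = 1`, PROVED** (Tate's archimedean
local computation): `HumphriesJo2024_archRankinSelberg_testVector 1 K` holds for every number field `K`.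
For `GL_1(K_∞) = K_∞ˣ` an irreducible unitary `τ` is a unitary character `ω` (Schur), every vector is
`K_∞`-finite, and `ψ_∞`-Whittaker functionals are arbitrary linear functionals; with
`η = ω ω̄' = ∏_{w real} sgn^{ε_w} |·|^{it_w} ∏_{w complex} (·/|·|)^{k_w} |·|^{it'_w}` and Tate's test
function `Φ_∞ = ∏_w x_w^{ε_w} e^{-π x_w²} ∏_w p_{k_w}(z_w) e^{-π|z_w|²}` (a polynomial times a Gaussian),
`Ψ_∞(s; W_e, W̄'_{e'}, Φ_∞) = ℓ(e) ℓ'(e')⁻ · vol(K_∞) · c_A · ∏_w Γ_ℝ(s + it_w + ε_w) ·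
∏_w (π/2) 2^{b_w} 2^s Γ_ℂ(s + b_w)`, `b_w = (it'_w + |k_w|)/2`, for `re s > 1` — of the asserted form
`c^s ∏ Γ_ℝ(s + a_j) ∏ Γ_ℂ(s + b_j)` with `c = 2^{r₂}`, `re a_j = ε_j ∈ {0, 1}`, `re b_j = |k_j|/2 ≥ 0`,
after normalising `e`; the integrability clause by the Gaussian bound `|Φ_∞(x)| ≤ C (1+‖x‖)^k e^{-m‖x‖²}`
and `d^×x = dx / N(x)`. [cite: HumphriesJo2024, Thm. 1.1 (the case n = 1)]
[cite: TateThesis1967, §2.5 (pp. 343–345)] [cite: CogdellAnalyticTheory2004, §3.1 item (1)] -/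
theorem HumphriesJo2024_archRankinSelberg_testVector_one :
    HumphriesJo2024_archRankinSelberg_testVector 1 K := by
  intro hcpt E _ _ _ τ hτ hτu hτi ℓ _hℓW hℓ0 E' _ _ _ τ' hτ' hτu' hτi' ℓ' _hℓ'W hℓ'0 mG hmG mU hmU μA hμA μK hμK
  -- Mathlib's (Borel) measurable structure on `K_∞ˣ`
  have hmU' : mU = Units.instMeasurableSpace := by
    rw [hmU.measurable_eq]
    exact (Literature.MeasureTheory.Group.Units.borelSpace_of_isOpenEmbedding (A := mixedSpace K)).measurable_eq.symm
  subst hmU'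
  haveI : IsHaarMeasure μA := hμA
  haveI : IsHaarMeasure μK := hμK
  haveI : SecondCountableTopology (GL (Fin 1) (mixedSpace K)) := secondCountableTopology_glInf 1 K
  haveI : CompactSpace ↥(Kinf 1 K) := isCompact_iff_compactSpace.mp (isCompact_Kinf_holds 1 K)
  haveI : BorelSpace (Fin 1 → (mixedSpace K)ˣ) := borelSpace_pi_mixedUnits (n := 1) (K := K)
  -- ### 1. the characters `ω`, `ω'` and `η = ω ω̄'`
  obtain ⟨ω, hωc, hω1, hω⟩ := exists_character_of_glOne (hcpt := hcpt) hτ hτu hτi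
  obtain ⟨ω', hω'c, hω'1, hω'⟩ := exists_character_of_glOne (hcpt := hcpt) hτ' hτu' hτi'
  let D : (mixedSpace K)ˣ →* GL (Fin 1) (mixedSpace K) :=
    { toFun := fun c => glDiagonal 1 (mixedSpace K) (fun _ => c)
      map_one' := map_one (glDiagonal 1 (mixedSpace K))
      map_mul' := fun a b => by rw [← map_mul]; rfl }
  have hD : ∀ c, D c = glDiagonal 1 (mixedSpace K) (fun _ => c) := fun c => rfl
  have hDdet : ∀ g : GL (Fin 1) (mixedSpace K), D (Matrix.GeneralLinearGroup.det g) = g := fun g => by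
    rw [hD]; exact (glOne_eq_glDiagonal_det g).symm
  have hDc : Continuous D := (continuous_glDiagonal (n := 1) (mixedSpace K)).comp (continuous_pi fun _ => continuous_id)
  let conjU : ℂˣ →* ℂˣ := Units.map ((starRingEnd ℂ : ℂ →+* ℂ) : ℂ →* ℂ)
  let η : (mixedSpace K)ˣ →* ℂˣ := (ω.comp D) * (conjU.comp (ω'.comp D))
  have hη : ∀ c, (η c : ℂ) = (ω (D c) : ℂ) * conj (ω' (D c) : ℂ) := fun c => rfl
  have hηc : Continuous fun c => (η c : ℂ) := by
    simp only [hη]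
    exact (hωc.comp hDc).mul (Complex.continuous_conj.comp (hω'c.comp hDc))
  have hη1 : ∀ c, ‖(η c : ℂ)‖ = 1 := fun c => by
    rw [hη, norm_mul, Complex.norm_conj, hω1, hω'1, mul_one]
  -- coordinate characters and their parameters
  have hreal : ∀ w : {w : InfinitePlace K // IsReal w}, ∃ (ε : ℕ) (t : ℝ), ε ≤ 1 ∧ ∀ x : ℝˣ,
      ((η (realUnitAt K w x) : ℂˣ) : ℂ) =
        (SignType.sign (x : ℝ) : ℂ) ^ ε * (((|(x : ℝ)| : ℝ) : ℂ)) ^ ((t : ℂ) * Complex.I) := fun w =>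
    Literature.Analysis.Complex.exists_sign_pow_mul_cpow_of_continuous_unitary_real
      (χ := η.comp (realUnitAt K w)) (hηc.comp (continuous_realUnitAt w)) (fun x => hη1 _)
  choose ε t hε1 hε using hreal
  have hcplx : ∀ w : {w : InfinitePlace K // IsComplex w}, ∃ (t' : ℝ) (k : ℤ), ∀ z : ℂˣ,
      ((η (complexUnitAt K w z) : ℂˣ) : ℂ) =
        ((‖(z : ℂ)‖ : ℂ)) ^ ((t' : ℂ) * Complex.I) * ((z : ℂ) / (‖(z : ℂ)‖ : ℂ)) ^ k := fun w =>
    Literature.Analysis.Complex.exists_cpow_mul_zpow_of_continuous_unitary_complex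
      (χ := η.comp (complexUnitAt K w)) (hηc.comp (continuous_complexUnitAt w)) (fun z => hη1 _)
  choose t' k hk using hcplx
  -- ### 2. Tate's test function and the radial profile
  obtain ⟨Φ, hΦpg, hΦ⟩ := exists_isArchPolyGaussian_tate K ε k
  let F : {w : InfinitePlace K // IsReal w} → ℝ → ℂ := fun w r =>
    ((r : ℝ) : ℂ) ^ (ε w) * ((r : ℝ) : ℂ) ^ ((t w : ℂ) * Complex.I) * ((Real.exp (-(Real.pi * r ^ 2)) : ℝ) : ℂ)
  let G : {w : InfinitePlace K // IsComplex w} → ℝ → ℂ := fun w r =>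
    (((r ^ (k w).natAbs : ℝ)) : ℂ) * ((r : ℝ) : ℂ) ^ ((t' w : ℂ) * Complex.I) *
      ((Real.exp (-(Real.pi * r ^ 2)) : ℝ) : ℂ)
  let R : mixedSpace K → ℂ := fun x => (∏ w, F w |x.1 w|) * ∏ w, G w ‖x.2 w‖
  have hRK : ∀ (x u : mixedSpace K), (∀ w, |u.1 w| = 1) → (∀ w, ‖u.2 w‖ = 1) → R (x * u) = R x := by
    intro x u hu1 hu2
    simp only [R, Prod.fst_mul, Prod.snd_mul, Pi.mul_apply, abs_mul, norm_mul, hu1, hu2, mul_one]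
  have hrad : ∀ c : (mixedSpace K)ˣ,
      (η c : ℂ) * Φ (fun _ => (InfiniteAdeleRing.ringEquiv_mixedSpace K).symm (c : mixedSpace K)) = R c := by
    intro c
    rw [char_units_eq_prod η c, hΦ, Units.val_mul, Units.coe_prod, Units.coe_prod]
    simp only [RingEquiv.apply_symm_apply, hε, hk, Units.val_mk0]
    rw [mul_mul_mul_comm, ← Finset.prod_mul_distrib, ← Finset.prod_mul_distrib]
    congr 1 <;> refine Finset.prod_congr rfl fun w _ => ?_
    · have hx : (c : mixedSpace K).1 w ≠ 0 := units_fst_ne_zero c w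
      calc (SignType.sign ((c : mixedSpace K).1 w) : ℂ) ^ ε w *
            ((((|(c : mixedSpace K).1 w| : ℝ)) : ℂ) ^ ((t w : ℂ) * Complex.I)) *
            ((((c : mixedSpace K).1 w : ℝ) : ℂ) ^ ε w *
              ((Real.exp (-(Real.pi * ((c : mixedSpace K).1 w) ^ 2)) : ℝ) : ℂ))
          = ((SignType.sign ((c : mixedSpace K).1 w) : ℂ) ^ ε w * ((((c : mixedSpace K).1 w : ℝ) : ℂ) ^ ε w)) *
              ((((|(c : mixedSpace K).1 w| : ℝ)) : ℂ) ^ ((t w : ℂ) * Complex.I)) *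
              ((Real.exp (-(Real.pi * ((c : mixedSpace K).1 w) ^ 2)) : ℝ) : ℂ) := by ring
        _ = F w |(c : mixedSpace K).1 w| := by
          rw [sign_pow_mul_pow_eq_abs_pow hx]
          simp only [F, sq_abs]
    · have hz : (c : mixedSpace K).2 w ≠ 0 := units_snd_ne_zero c w
      calc ((‖(c : mixedSpace K).2 w‖ : ℂ)) ^ ((t' w : ℂ) * Complex.I) *
            (((c : mixedSpace K).2 w) / (‖(c : mixedSpace K).2 w‖ : ℂ)) ^ k w *
            ((if 0 ≤ k w then (conj ((c : mixedSpace K).2 w)) ^ (k w).toNat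
              else ((c : mixedSpace K).2 w) ^ (-(k w)).toNat) *
              ((Real.exp (-(Real.pi * ‖(c : mixedSpace K).2 w‖ ^ 2)) : ℝ) : ℂ))
          = ((((c : mixedSpace K).2 w) / (‖(c : mixedSpace K).2 w‖ : ℂ)) ^ k w *
              (if 0 ≤ k w then (conj ((c : mixedSpace K).2 w)) ^ (k w).toNat
                else ((c : mixedSpace K).2 w) ^ (-(k w)).toNat)) *
              ((‖(c : mixedSpace K).2 w‖ : ℂ)) ^ ((t' w : ℂ) * Complex.I) *
              ((Real.exp (-(Real.pi * ‖(c : mixedSpace K).2 w‖ ^ 2)) : ℝ) : ℂ) := by ring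
        _ = G w ‖(c : mixedSpace K).2 w‖ := by
          rw [div_norm_zpow_mul_tatePoly hz]
  -- ### 3. the integrand depends only on `y₀`
  have hℓe : ∀ (g : GL (Fin 1) (mixedSpace K)) (v : archGardingSpace hcpt τ),
      ℓ ⟨τ (toArch hcpt g) (v : E), apply_mem_archGardingSpace hτ _ v.2⟩ = (ω g : ℂ) * ℓ v := by
    intro g v
    have h : (⟨τ (toArch hcpt g) (v : E), apply_mem_archGardingSpace hτ _ v.2⟩ : archGardingSpace hcpt τ) =
        (ω g : ℂ) • v := Subtype.ext (hω g v)
    rw [h, map_smul, smul_eq_mul]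
  have hℓe' : ∀ (g : GL (Fin 1) (mixedSpace K)) (v : archGardingSpace hcpt τ'),
      ℓ' ⟨τ' (toArch hcpt g) (v : E'), apply_mem_archGardingSpace hτ' _ v.2⟩ = (ω' g : ℂ) * ℓ' v := by
    intro g v
    have h : (⟨τ' (toArch hcpt g) (v : E'), apply_mem_archGardingSpace hτ' _ v.2⟩ : archGardingSpace hcpt τ') =
        (ω' g : ℂ) • v := Subtype.ext (hω' g v)
    rw [h, map_smul, smul_eq_mul]
  -- `H(c) = R(c) N(c)^s` and the pointwise identity
  let Hf : ℂ → mixedSpace K → ℂ := fun s x => R x * (((mixedEmbedding.norm x : ℝ)) : ℂ) ^ s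
  have hfun : ∀ (v : archGardingSpace hcpt τ) (v' : archGardingSpace hcpt τ') (s : ℂ),
      (fun p : (Fin 1 → (mixedSpace K)ˣ) × ↥(Kinf 1 K) =>
        ℓ ⟨τ (toArch hcpt (glDiagonal 1 (mixedSpace K) p.1 * (p.2 : GL (Fin 1) (mixedSpace K)))) (v : E),
            apply_mem_archGardingSpace hτ _ v.2⟩ *
          conj (ℓ' ⟨τ' (toArch hcpt (glDiagonal 1 (mixedSpace K) p.1 * (p.2 : GL (Fin 1) (mixedSpace K))))
            (v' : E'), apply_mem_archGardingSpace hτ' _ v'.2⟩) *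
          Φ (archLastRow 1 K (glDiagonal 1 (mixedSpace K) p.1 * (p.2 : GL (Fin 1) (mixedSpace K)))) *
          archTorusWeightC 1 K s p.1) =
      fun p => (fun y : Fin 1 → (mixedSpace K)ˣ => (ℓ v * conj (ℓ' v')) * Hf s ((y 0 : (mixedSpace K)ˣ) : mixedSpace K)) p.1 := by
    intro v v' s
    funext p
    set g : GL (Fin 1) (mixedSpace K) := glDiagonal 1 (mixedSpace K) p.1 * (p.2 : GL (Fin 1) (mixedSpace K)) with hg
    have hdet : Matrix.GeneralLinearGroup.det g = p.1 0 * Matrix.GeneralLinearGroup.det (p.2 : GL (Fin 1) (mixedSpace K)) :=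
      det_glDiagonal_one_mul p.1 _
    have hηg : (ω g : ℂ) * conj (ω' g : ℂ) = (η (Matrix.GeneralLinearGroup.det g) : ℂ) := by
      rw [hη, hDdet]
    rw [hℓe, hℓe', archLastRow_glOne, archTorusWeightC_one, map_mul (starRingEnd ℂ) ((ω' g : ℂ)) (ℓ' v')]
    dsimp only
    have hR : R ((Matrix.GeneralLinearGroup.det g : (mixedSpace K)ˣ) : mixedSpace K) = R ((p.1 0 : (mixedSpace K)ˣ) : mixedSpace K) := by
      rw [hdet, Units.val_mul]
      exact hRK _ _ (abs_fst_det_eq_one_of_mem_Kinf p.2) (norm_snd_det_eq_one_of_mem_Kinf p.2)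
    calc (ω g : ℂ) * ℓ v * (conj (ω' g : ℂ) * conj (ℓ' v')) *
          Φ (fun _ => (InfiniteAdeleRing.ringEquiv_mixedSpace K).symm
            ((Matrix.GeneralLinearGroup.det g : (mixedSpace K)ˣ) : mixedSpace K)) *
          ((mixedEmbedding.norm ((p.1 0 : (mixedSpace K)ˣ) : mixedSpace K) : ℝ) : ℂ) ^ s
        = ℓ v * conj (ℓ' v') * (((ω g : ℂ) * conj (ω' g : ℂ)) *
            Φ (fun _ => (InfiniteAdeleRing.ringEquiv_mixedSpace K).symm
              ((Matrix.GeneralLinearGroup.det g : (mixedSpace K)ˣ) : mixedSpace K))) *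
          ((mixedEmbedding.norm ((p.1 0 : (mixedSpace K)ˣ) : mixedSpace K) : ℝ) : ℂ) ^ s := by ring
      _ = ℓ v * conj (ℓ' v') * Hf s ((p.1 0 : (mixedSpace K)ˣ) : mixedSpace K) := by
          rw [hηg, hrad, hR]
          simp only [Hf]
          ring
  -- ### 4. Haar measures
  set eU : (Fin 1 → (mixedSpace K)ˣ) ≃ᵐ (mixedSpace K)ˣ := MeasurableEquiv.funUnique (Fin 1) (mixedSpace K)ˣ with heU
  haveI hHaar : IsHaarMeasure (μA.map eU) := by
    have hco : (⇑eU : (Fin 1 → (mixedSpace K)ˣ) → (mixedSpace K)ˣ) = ⇑(MulEquiv.funUnique (Fin 1) (mixedSpace K)ˣ) := rfl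
    rw [hco]
    exact MulEquiv.isHaarMeasure_map μA _ (continuous_apply _) (continuous_pi fun _ => continuous_id)
  obtain ⟨cA, hcA, hcAint⟩ := exists_integral_units_eq_mul_integral K (μA.map eU)
  have hKpos : 0 < μK.real univ :=
    ENNReal.toReal_pos (IsOpenPosMeasure.open_pos _ isOpen_univ univ_nonempty) (measure_ne_top μK _)
  -- ### 5. the local integrals
  -- shifts
  let aw : {w : InfinitePlace K // IsReal w} → ℂ := fun w => (t w : ℂ) * Complex.I + (ε w : ℂ)
  let bw : {w : InfinitePlace K // IsComplex w} → ℂ := fun w => ((t' w : ℂ) * Complex.I + ((k w).natAbs : ℂ)) / 2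
  have haw : ∀ w, (aw w).re = ε w := fun w => by simp [aw]
  have hbw : ∀ w, (bw w).re = ((k w).natAbs : ℝ) / 2 := fun w => by simp [bw]
  -- the one-variable integrands
  set f₁ : ℂ → {w : InfinitePlace K // IsReal w} → ℝ → ℂ := fun s w r =>
    F w |r| * (((|r| : ℝ)) : ℂ) ^ s * (((|r|⁻¹ : ℝ)) : ℂ) with hf₁def
  set g₁ : ℂ → {w : InfinitePlace K // IsComplex w} → ℂ → ℂ := fun s w z =>
    G w ‖z‖ * ((((‖z‖ ^ 2 : ℝ)) : ℂ) ^ s) * ((((‖z‖ ^ 2)⁻¹ : ℝ)) : ℂ) with hg₁def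
  -- the real factor
  have hFint : ∀ (w) (s : ℂ), 1 < s.re → ∫ r : ℝ, f₁ s w r = Complex.Gammaℝ (s + aw w) := by
    intro w s hs
    have hs' : 0 < (s + aw w).re := by rw [Complex.add_re, haw]; positivity
    rw [← TateArchimedean.zeta_real_trivial hs']
    refine integral_congr_ae ?_
    have h0 : ∀ᵐ r : ℝ, r ≠ 0 := by simp [ae_iff]
    filter_upwards [h0] with r hr
    have ha : (0 : ℝ) < |r| := abs_pos.mpr hr
    have ha0 : (((|r| : ℝ)) : ℂ) ≠ 0 := Complex.ofReal_ne_zero.mpr ha.ne'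
    simp only [hf₁def, F, sq_abs]
    rw [Complex.ofReal_inv, ← Complex.cpow_neg_one, ← Complex.cpow_natCast,
      show s + aw w - 1 = (ε w : ℂ) + (t w : ℂ) * Complex.I + s + (-1) by simp only [aw]; ring,
      Complex.cpow_add _ _ ha0, Complex.cpow_add _ _ ha0, Complex.cpow_add _ _ ha0]
    push_cast
    ring
  -- the complex factor
  have hGint : ∀ (w) (s : ℂ), 1 < s.re → ∫ z : ℂ, g₁ s w z =
        (Real.pi / 2 : ℂ) * (2 : ℂ) ^ (bw w) * (2 : ℂ) ^ s * Complex.Gammaℂ (s + bw w) := by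
    intro w s hs
    have hs' : 0 < (s + bw w).re := by rw [Complex.add_re, hbw]; positivity
    have key := integral_complex_normSq_cpow_mul_exp hs' Real.pi_pos
    have hlhs : ∫ z : ℂ, g₁ s w z =
        ∫ z : ℂ, (((‖z‖ ^ 2 : ℝ)) : ℂ) ^ (s + bw w - 1) * Complex.exp (-Real.pi * (((‖z‖ ^ 2 : ℝ)) : ℂ)) := by
      refine integral_congr_ae ?_
      have h0 : ∀ᵐ z : ℂ ∂volume, z ≠ 0 := by simp [ae_iff]
      filter_upwards [h0] with z hz
      have hn : 0 < ‖z‖ := norm_pos_iff.mpr hz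
      have hn2 : (0 : ℝ) < ‖z‖ ^ 2 := by positivity
      have hn20 : (((‖z‖ ^ 2 : ℝ)) : ℂ) ≠ 0 := Complex.ofReal_ne_zero.mpr hn2.ne'
      simp only [hg₁def, G]
      -- `‖z‖^{|k|} = (‖z‖²)^{|k|/2}`, `‖z‖^{it'} = (‖z‖²)^{it'/2}`
      have h1 : (((‖z‖ ^ (k w).natAbs : ℝ)) : ℂ) = (((‖z‖ ^ 2 : ℝ)) : ℂ) ^ (((k w).natAbs : ℂ) / 2) := by
        rw [TateArchimedean.ofReal_sq_cpow hn, mul_div_cancel₀ _ (two_ne_zero' ℂ), Complex.cpow_natCast,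
          Complex.ofReal_pow]
      have h2 : ((‖z‖ : ℂ)) ^ ((t' w : ℂ) * Complex.I) = (((‖z‖ ^ 2 : ℝ)) : ℂ) ^ ((t' w : ℂ) * Complex.I / 2) := by
        rw [TateArchimedean.ofReal_sq_cpow hn, mul_div_cancel₀ _ (two_ne_zero' ℂ)]
      rw [h1, h2, Complex.ofReal_inv, ← Complex.cpow_neg_one,
        show s + bw w - 1 = ((k w).natAbs : ℂ) / 2 + (t' w : ℂ) * Complex.I / 2 + s + (-1) by
          simp only [bw]; ring,
        Complex.cpow_add _ _ hn20, Complex.cpow_add _ _ hn20, Complex.cpow_add _ _ hn20]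
      push_cast
      ring
    rw [hlhs, key, Complex.Gammaℂ_def]
    -- `π (1/π)^a Γ(a) = (π/2) 2^b 2^s · 2 (2π)^{-a} Γ(a)`, `a = s + b`
    have hπ0 : (Real.pi : ℂ) ≠ 0 := Complex.ofReal_ne_zero.mpr Real.pi_ne_zero
    have h2π : ((2 * Real.pi : ℂ)) ^ (-(s + bw w)) = (2 : ℂ) ^ (-(s + bw w)) * (Real.pi : ℂ) ^ (-(s + bw w)) := by
      have h := Complex.mul_cpow_ofReal_nonneg (zero_le_two) Real.pi_pos.le (-(s + bw w))
      push_cast at h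
      exact h
    have h1π : ((1 / Real.pi : ℂ)) ^ (s + bw w) = (Real.pi : ℂ) ^ (-(s + bw w)) := by
      rw [one_div, Complex.inv_cpow _ _ (by rw [Complex.arg_ofReal_of_nonneg Real.pi_pos.le]; exact Real.pi_ne_zero.symm),
        Complex.cpow_neg]
    have h2s : (2 : ℂ) ^ (bw w) * (2 : ℂ) ^ s * (2 : ℂ) ^ (-(s + bw w)) = 1 := by
      rw [← Complex.cpow_add _ _ two_ne_zero, ← Complex.cpow_add _ _ two_ne_zero,
        show bw w + s + -(s + bw w) = 0 by ring, Complex.cpow_zero]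
    rw [h1π, h2π]
    linear_combination -(Real.pi : ℂ) * (Real.pi : ℂ) ^ (-(s + bw w)) * Complex.Gamma (s + bw w) * h2s
  -- ### 6. the integral for arbitrary `v, v'`
  clear_value f₁ g₁ F G
  have hint : ∀ (v : archGardingSpace hcpt τ) (v' : archGardingSpace hcpt τ') (s : ℂ), 1 < s.re →
      archRankinSelbergPairIntegralCplx hcpt τ hτ τ' hτ' ℓ ℓ' v v' Φ μA μK s =
        (ℓ v * conj (ℓ' v')) * ((μK.real univ : ℂ) * (cA : ℂ) *
          ((∏ w, Complex.Gammaℝ (s + aw w)) *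
            ∏ w, ((Real.pi / 2 : ℂ) * (2 : ℂ) ^ (bw w) * (2 : ℂ) ^ s * Complex.Gammaℂ (s + bw w)))) := by
    intro v v' s hs
    unfold archRankinSelbergPairIntegralCplx
    rw [hfun v v' s,
      MeasureTheory.integral_fun_fst (μ := μA) (ν := μK)
        (fun y : Fin 1 → (mixedSpace K)ˣ => ℓ v * conj (ℓ' v') * Hf s ((y 0 : (mixedSpace K)ˣ) : mixedSpace K)),
      integral_const_mul]
    -- to `K_∞ˣ`
    have h3 : ∫ y : Fin 1 → (mixedSpace K)ˣ, Hf s ((y 0 : (mixedSpace K)ˣ) : mixedSpace K) ∂μA =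
        ∫ c : (mixedSpace K)ˣ, Hf s (c : mixedSpace K) ∂(μA.map eU) := by
      rw [integral_map_equiv]
      rfl
    rw [h3, hcAint (Hf s)]
    -- on `K_∞`: `N(x)⁻¹ H(x) = ∏ f_w ∏ g_w` a.e.
    have h5 : ∫ x : mixedSpace K, (mixedEmbedding.norm x)⁻¹ • Hf s x =
        ∫ x : mixedSpace K, (∏ w, f₁ s w (x.1 w)) * ∏ w, g₁ s w (x.2 w) := by
      refine integral_congr_ae ?_
      filter_upwards [ae_isUnit_mixedSpace K] with x hx
      have hf₁ : ∀ w, f₁ s w (x.1 w) = F w |x.1 w| * (((|x.1 w| : ℝ)) : ℂ) ^ s * (((|x.1 w|⁻¹ : ℝ)) : ℂ) :=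
        fun w => by rw [hf₁def]
      have hg₁ : ∀ w, g₁ s w (x.2 w) = G w ‖x.2 w‖ * ((((‖x.2 w‖ ^ 2 : ℝ)) : ℂ) ^ s) * ((((‖x.2 w‖ ^ 2)⁻¹ : ℝ)) : ℂ) :=
        fun w => by rw [hg₁def]
      simp only [hf₁, hg₁]
      have hN : mixedEmbedding.norm x = (∏ w : {w : InfinitePlace K // IsReal w}, |x.1 w|) *
          ∏ w : {w : InfinitePlace K // IsComplex w}, ‖x.2 w‖ ^ 2 := by
        rw [mixedEmbedding.norm_apply, prod_eq_prod_mul_prod]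
        congr 1
        · refine Finset.prod_congr rfl fun w _ => ?_
          rw [normAtPlace_apply_of_isReal w.2, mult_isReal, pow_one, Real.norm_eq_abs]
        · refine Finset.prod_congr rfl fun w _ => ?_
          rw [normAtPlace_apply_of_isComplex w.2, mult_isComplex]
      simp only [Hf, R, Complex.real_smul, hN]
      rw [Complex.ofReal_mul, Complex.mul_cpow_ofReal_nonneg (Finset.prod_nonneg fun w _ => abs_nonneg _)
          (Finset.prod_nonneg fun w _ => by positivity),
        ofReal_prod_cpow_of_nonneg _ _ (fun w => abs_nonneg _), ofReal_prod_cpow_of_nonneg _ _ (fun w => by positivity),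
        mul_inv]
      push_cast
      rw [← Finset.prod_inv_distrib, ← Finset.prod_inv_distrib, Finset.prod_mul_distrib, Finset.prod_mul_distrib,
        Finset.prod_mul_distrib, Finset.prod_mul_distrib]
      ring
    rw [h5, integral_mixedSpace_prod_eq_prod K (f₁ s) (g₁ s)]
    rw [Finset.prod_congr rfl fun w _ => hFint w s hs, Finset.prod_congr rfl fun w _ => hGint w s hs]
    simp only [Complex.real_smul]
    ring
  -- ### 7. the test vectors
  obtain ⟨e₀, he₀⟩ : ∃ v : archGardingSpace hcpt τ, ℓ v ≠ 0 := by
    by_contra h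
    push Not at h
    exact hℓ0 (LinearMap.ext fun v => by rw [h v, LinearMap.zero_apply])
  obtain ⟨e'₀, he'₀⟩ : ∃ v : archGardingSpace hcpt τ', ℓ' v ≠ 0 := by
    by_contra h
    push Not at h
    exact hℓ'0 (LinearMap.ext fun v => by rw [h v, LinearMap.zero_apply])
  -- the constant to normalise away
  set Cst : ℂ := (μK.real univ : ℂ) * (cA : ℂ) * ∏ w, ((Real.pi / 2 : ℂ) * (2 : ℂ) ^ (bw w)) with hCst
  have hCst0 : Cst ≠ 0 := by
    rw [hCst]
    refine mul_ne_zero (mul_ne_zero ?_ ?_) (Finset.prod_ne_zero_iff.mpr fun w _ => mul_ne_zero ?_ ?_)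
    · exact_mod_cast hKpos.ne'
    · exact_mod_cast hcA.ne'
    · exact div_ne_zero (Complex.ofReal_ne_zero.mpr Real.pi_ne_zero) two_ne_zero
    · exact Complex.cpow_ne_zero_iff.mpr (Or.inl two_ne_zero)
  set α : ℂ := (ℓ e₀ * conj (ℓ' e'₀) * Cst)⁻¹ with hα
  set e : archGardingSpace hcpt τ := α • e₀ with he
  -- `K_∞`-finiteness: every vector of a character is `K_∞`-finite
  have hfinτ : ∀ v : archGardingSpace hcpt τ, FiniteDimensional ℂ (Submodule.span ℂ (Set.range
      fun κ : (AutomorphyDatum.gl 1 K hcpt).arch.maximalCompact => τ (toArch hcpt (κ : GL (Fin 1) (mixedSpace K))) (v : E))) := by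
    intro v
    have hle : Submodule.span ℂ (Set.range fun κ : (AutomorphyDatum.gl 1 K hcpt).arch.maximalCompact =>
        τ (toArch hcpt (κ : GL (Fin 1) (mixedSpace K))) (v : E)) ≤ Submodule.span ℂ {(v : E)} := by
      refine Submodule.span_le.mpr ?_
      rintro _ ⟨κ, rfl⟩
      show τ (toArch hcpt (κ : GL (Fin 1) (mixedSpace K))) (v : E) ∈ _
      rw [hω]
      exact Submodule.smul_mem _ _ (Submodule.subset_span rfl)
    haveI : FiniteDimensional ℂ (Submodule.span ℂ {(v : E)}) := FiniteDimensional.span_of_finite ℂ (Set.finite_singleton _)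
    exact Submodule.finiteDimensional_of_le hle
  have hfinτ' : ∀ v : archGardingSpace hcpt τ', FiniteDimensional ℂ (Submodule.span ℂ (Set.range
      fun κ : (AutomorphyDatum.gl 1 K hcpt).arch.maximalCompact => τ' (toArch hcpt (κ : GL (Fin 1) (mixedSpace K))) (v : E'))) := by
    intro v
    have hle : Submodule.span ℂ (Set.range fun κ : (AutomorphyDatum.gl 1 K hcpt).arch.maximalCompact =>
        τ' (toArch hcpt (κ : GL (Fin 1) (mixedSpace K))) (v : E')) ≤ Submodule.span ℂ {(v : E')} := by
      refine Submodule.span_le.mpr ?_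
      rintro _ ⟨κ, rfl⟩
      show τ' (toArch hcpt (κ : GL (Fin 1) (mixedSpace K))) (v : E') ∈ _
      rw [hω']
      exact Submodule.smul_mem _ _ (Submodule.subset_span rfl)
    haveI : FiniteDimensional ℂ (Submodule.span ℂ {(v : E')}) := FiniteDimensional.span_of_finite ℂ (Set.finite_singleton _)
    exact Submodule.finiteDimensional_of_le hle
  -- enumerations of the places
  let eR : {w : InfinitePlace K // IsReal w} ≃ Fin (Fintype.card {w : InfinitePlace K // IsReal w}) := Fintype.equivFin _
  let eC : {w : InfinitePlace K // IsComplex w} ≃ Fin (Fintype.card {w : InfinitePlace K // IsComplex w}) := Fintype.equivFin _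
  refine ⟨⟨e, e'₀, hfinτ e, hfinτ' e'₀, Φ, hΦpg, (2 : ℝ) ^ Fintype.card {w : InfinitePlace K // IsComplex w},
    by positivity, _, _, fun j => aw (eR.symm j), fun j => bw (eC.symm j),
    fun j => by rw [haw]; linarith [(Nat.cast_nonneg (ε (eR.symm j)) : (0 : ℝ) ≤ _)],
    fun j => by rw [hbw]; linarith [(Nat.cast_nonneg ((k (eC.symm j)).natAbs) : (0 : ℝ) ≤ _)],
    fun s hs => ?_⟩, ?_⟩
  · -- ### 8. the identity
    rw [hint e e'₀ s hs]
    dsimp only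
    rw [Fintype.prod_equiv eR.symm (fun j => Complex.Gammaℝ (s + aw (eR.symm j))) (fun w => Complex.Gammaℝ (s + aw w))
        (fun _ => rfl),
      Fintype.prod_equiv eC.symm (fun j => Complex.Gammaℂ (s + bw (eC.symm j))) (fun w => Complex.Gammaℂ (s + bw w))
        (fun _ => rfl), ofReal_two_pow_cpow]
    have hℓe_val : ℓ e = α * ℓ e₀ := by rw [he, map_smul, smul_eq_mul]
    have hsplit : ∏ w, ((Real.pi / 2 : ℂ) * (2 : ℂ) ^ (bw w) * (2 : ℂ) ^ s * Complex.Gammaℂ (s + bw w)) =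
        (∏ w, ((Real.pi / 2 : ℂ) * (2 : ℂ) ^ (bw w))) * ((2 : ℂ) ^ s) ^ Fintype.card {w : InfinitePlace K // IsComplex w} *
          ∏ w, Complex.Gammaℂ (s + bw w) := by
      rw [Finset.prod_mul_distrib, Finset.prod_mul_distrib, Finset.prod_const, Finset.card_univ]
    have hA0 : ℓ e₀ * conj (ℓ' e'₀) ≠ 0 := mul_ne_zero he₀ (by rwa [map_ne_zero])
    have hkey : α * (ℓ e₀ * conj (ℓ' e'₀)) * Cst = 1 := by
      rw [hα, mul_assoc, inv_mul_cancel₀ (mul_ne_zero hA0 hCst0)]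
    rw [hℓe_val, hsplit]
    rw [hCst] at hkey
    linear_combination ((2 : ℂ) ^ s) ^ Fintype.card {w : InfinitePlace K // IsComplex w} *
      (∏ w, Complex.Gammaℝ (s + aw w)) * (∏ w, Complex.Gammaℂ (s + bw w)) * hkey
  · -- ### 9. integrability for every polynomial-times-Gaussian
    intro v v' _ _ Ψ hΨ s hs
    obtain ⟨Nq, L, q, T, hΨ⟩ := hΨ
    -- `Ψ(e_1 g) = Ψ̃(det g)` with `Ψ̃` continuous on `K_∞`
    let Ψt : mixedSpace K → ℂ := fun x => MvPolynomial.eval (fun i => ((L i (fun _ : Fin 1 => x) : ℝ) : ℂ)) q *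
      ((Real.exp (-‖T (fun _ : Fin 1 => x)‖ ^ 2) : ℝ) : ℂ)
    have hΨt : ∀ c : mixedSpace K, Ψ (fun _ => (InfiniteAdeleRing.ringEquiv_mixedSpace K).symm c) = Ψt c := by
      intro c
      rw [hΨ]
      simp only [RingEquiv.apply_symm_apply, Ψt]
    have hΨtc : Continuous Ψt := by
      refine Continuous.mul ?_ ?_
      · have hc : Continuous fun x : mixedSpace K => fun i => ((L i (fun _ : Fin 1 => x) : ℝ) : ℂ) :=
          continuous_pi fun i => Complex.continuous_ofReal.comp ((L i).continuous.comp (continuous_pi fun _ => continuous_id))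
        exact (MvPolynomial.continuous_eval q).comp hc
      · exact Complex.continuous_ofReal.comp (Real.continuous_exp.comp
          ((T.continuous.comp (continuous_pi fun _ => continuous_id)).norm.pow 2).neg)
    obtain ⟨Cq, kq, m, hCq, hm, hbound⟩ := exists_polyGaussian_bound L q T
    -- the integrand and its continuity
    set A : ℂ := ℓ v * conj (ℓ' v') with hAdef
    clear_value A
    have hfun2 : (fun p : (Fin 1 → (mixedSpace K)ˣ) × ↥(Kinf 1 K) =>
        ℓ ⟨τ (toArch hcpt (glDiagonal 1 (mixedSpace K) p.1 * (p.2 : GL (Fin 1) (mixedSpace K)))) (v : E),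
            apply_mem_archGardingSpace hτ _ v.2⟩ *
          conj (ℓ' ⟨τ' (toArch hcpt (glDiagonal 1 (mixedSpace K) p.1 * (p.2 : GL (Fin 1) (mixedSpace K))))
            (v' : E'), apply_mem_archGardingSpace hτ' _ v'.2⟩) *
          Ψ (archLastRow 1 K (glDiagonal 1 (mixedSpace K) p.1 * (p.2 : GL (Fin 1) (mixedSpace K)))) *
          archTorusWeightC 1 K s p.1) =
        fun p => A * ((η (Matrix.GeneralLinearGroup.det (glDiagonal 1 (mixedSpace K) p.1 * (p.2 : GL (Fin 1) (mixedSpace K)))) : ℂ) *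
          Ψt ((Matrix.GeneralLinearGroup.det (glDiagonal 1 (mixedSpace K) p.1 * (p.2 : GL (Fin 1) (mixedSpace K))) : (mixedSpace K)ˣ) : mixedSpace K) *
          ((mixedEmbedding.norm ((p.1 0 : (mixedSpace K)ˣ) : mixedSpace K) : ℝ) : ℂ) ^ s) := by
      funext p
      set g : GL (Fin 1) (mixedSpace K) := glDiagonal 1 (mixedSpace K) p.1 * (p.2 : GL (Fin 1) (mixedSpace K)) with hg
      rw [hℓe, hℓe', archLastRow_glOne, archTorusWeightC_one, map_mul (starRingEnd ℂ) ((ω' g : ℂ)) (ℓ' v'), hΨt, hη,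
        hDdet, hAdef]
      ring
    have hcont : Continuous fun p : (Fin 1 → (mixedSpace K)ˣ) × ↥(Kinf 1 K) =>
        A * ((η (Matrix.GeneralLinearGroup.det (glDiagonal 1 (mixedSpace K) p.1 * (p.2 : GL (Fin 1) (mixedSpace K)))) : ℂ) *
          Ψt ((Matrix.GeneralLinearGroup.det (glDiagonal 1 (mixedSpace K) p.1 * (p.2 : GL (Fin 1) (mixedSpace K))) : (mixedSpace K)ˣ) : mixedSpace K) *
          ((mixedEmbedding.norm ((p.1 0 : (mixedSpace K)ˣ) : mixedSpace K) : ℝ) : ℂ) ^ s) := by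
      have hg : Continuous fun p : (Fin 1 → (mixedSpace K)ˣ) × ↥(Kinf 1 K) =>
          glDiagonal 1 (mixedSpace K) p.1 * (p.2 : GL (Fin 1) (mixedSpace K)) := continuous_glDiagonal_mul_kinf
      have hdetc : Continuous fun p : (Fin 1 → (mixedSpace K)ˣ) × ↥(Kinf 1 K) =>
          Matrix.GeneralLinearGroup.det (glDiagonal 1 (mixedSpace K) p.1 * (p.2 : GL (Fin 1) (mixedSpace K))) := by
        refine Units.continuous_iff.mpr ⟨?_, ?_⟩
        · exact (Units.continuous_val.comp hg).matrix_det
        · exact (Units.continuous_coe_inv.comp hg).matrix_det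
      refine continuous_const.mul (((hηc.comp hdetc).mul (hΨtc.comp (Units.continuous_val.comp hdetc))).mul ?_)
      have hN : Continuous fun p : (Fin 1 → (mixedSpace K)ˣ) × ↥(Kinf 1 K) =>
          (((mixedEmbedding.norm ((p.1 0 : (mixedSpace K)ˣ) : mixedSpace K) : ℝ)) : ℂ) :=
        Complex.continuous_ofReal.comp ((mixedEmbedding.continuous_norm K).comp
          (Units.continuous_val.comp ((continuous_apply (0 : Fin 1)).comp continuous_fst)))
      exact hN.cpow continuous_const fun p => Complex.ofReal_mem_slitPlane.mpr (mixedEmbedding_norm_units_pos _)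
    rw [hfun2]
    -- the dominating function of `y₀`
    set σ : ℝ := s.re with hσ
    have hσ1 : 1 < σ := hs
    let B₀ : mixedSpace K → ℝ := fun x => ‖A‖ * Cq * (1 + ‖x‖) ^ kq * Real.exp (-m * ‖x‖ ^ 2) *
      (mixedEmbedding.norm x) ^ σ
    have hB₀m : Measurable B₀ := by
      refine Continuous.measurable ?_
      refine (((continuous_const.mul ((continuous_const.add continuous_norm).pow kq)).mul
        (Real.continuous_exp.comp (continuous_const.mul (continuous_norm.pow 2)))).mul ?_)
      exact Continuous.rpow_const (mixedEmbedding.continuous_norm K) fun x => Or.inr (by linarith)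
    -- integrability of `B₀` against the Haar measure of `K_∞ˣ`
    have hB₀int : Integrable (fun c : (mixedSpace K)ˣ => B₀ (c : mixedSpace K)) (μA.map eU) := by
      refine Literature.MeasureTheory.Group.integrable_comp_val_of_integrable volume (μA.map eU) hB₀m ?_
      -- dominated by `Cfin (1 + ‖x‖)^{-(D+1)}` on the units
      set D : ℕ := Module.finrank ℝ (mixedSpace K) with hDdef
      set P : ℝ := (kq : ℝ) + (Module.finrank ℚ K : ℝ) * (σ - 1) + (D + 1) with hPdef
      have hP0 : 0 ≤ P := by
        have h2 : (0 : ℝ) ≤ (Module.finrank ℚ K : ℝ) * (σ - 1) := mul_nonneg (Nat.cast_nonneg _) (by linarith)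
        rw [hPdef]
        linarith [(Nat.cast_nonneg kq : (0 : ℝ) ≤ _), (Nat.cast_nonneg D : (0 : ℝ) ≤ _)]
      set Cfin : ℝ := ‖A‖ * Cq * Real.exp (P ^ 2 / (4 * m)) with hCfin
      have hI : Integrable (fun x : mixedSpace K => Cfin * (1 + ‖x‖) ^ (-((D : ℝ) + 1)))
          (volume.restrict {x : mixedSpace K | IsUnit x}) :=
        ((integrable_one_add_norm (E := mixedSpace K) (μ := volume) (r := (D : ℝ) + 1)
          (by rw [hDdef]; linarith)).const_mul Cfin).restrict
      refine Integrable.mono' hI ?_ ?_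
      · exact ((Literature.MeasureTheory.Group.continuous_algebraNorm.measurable.inv.norm).mul hB₀m).aestronglyMeasurable
      · filter_upwards [ae_restrict_mem (Units.isOpen (R := mixedSpace K)).measurableSet] with x hx
        have hNx : 0 < mixedEmbedding.norm x :=
          lt_of_le_of_ne (mixedEmbedding.norm_nonneg _) (Ne.symm (norm_ne_zero_of_isUnit K hx))
        rw [Real.norm_eq_abs, abs_mul, abs_abs, abs_inv, Literature.RingTheory.Norm.abs_algebraNorm_mixedSpace,
          abs_of_nonneg (by positivity : (0 : ℝ) ≤ B₀ x)]
        simp only [B₀]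
        -- `N⁻¹ N^σ = N^{σ-1} ≤ (1+‖x‖)^{d₀(σ-1)}`
        have h1 : (mixedEmbedding.norm x)⁻¹ * (mixedEmbedding.norm x) ^ σ = (mixedEmbedding.norm x) ^ (σ - 1) := by
          rw [Real.rpow_sub_one hNx.ne', div_eq_inv_mul]
        have h2 : (mixedEmbedding.norm x) ^ (σ - 1) ≤ (1 + ‖x‖) ^ ((Module.finrank ℚ K : ℝ) * (σ - 1)) := by
          calc (mixedEmbedding.norm x) ^ (σ - 1) ≤ ((1 + ‖x‖) ^ Module.finrank ℚ K) ^ (σ - 1) :=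
                Real.rpow_le_rpow (mixedEmbedding.norm_nonneg _) (mixedEmbedding_norm_le_one_add_norm_pow x) (by linarith)
            _ = (1 + ‖x‖) ^ ((Module.finrank ℚ K : ℝ) * (σ - 1)) := by
                rw [← Real.rpow_natCast, ← Real.rpow_mul (by positivity)]
        have h3 : (1 + ‖x‖) ^ kq * (1 + ‖x‖) ^ ((Module.finrank ℚ K : ℝ) * (σ - 1)) =
            (1 + ‖x‖) ^ P * (1 + ‖x‖) ^ (-((D : ℝ) + 1)) := by
          rw [← Real.rpow_natCast, ← Real.rpow_add (by positivity), ← Real.rpow_add (by positivity), hPdef]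
          ring_nf
        have h4 := one_add_rpow_mul_exp_neg_mul_sq_le hP0 hm (norm_nonneg x)
        have hpos1 : 0 ≤ (1 + ‖x‖) ^ (-((D : ℝ) + 1)) := by positivity
        calc (mixedEmbedding.norm x)⁻¹ * (‖A‖ * Cq * (1 + ‖x‖) ^ kq * Real.exp (-m * ‖x‖ ^ 2) * (mixedEmbedding.norm x) ^ σ)
            = ‖A‖ * Cq * ((1 + ‖x‖) ^ kq * ((mixedEmbedding.norm x)⁻¹ * (mixedEmbedding.norm x) ^ σ)) *
                Real.exp (-m * ‖x‖ ^ 2) := by ring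
          _ ≤ ‖A‖ * Cq * ((1 + ‖x‖) ^ kq * (1 + ‖x‖) ^ ((Module.finrank ℚ K : ℝ) * (σ - 1))) * Real.exp (-m * ‖x‖ ^ 2) := by
                rw [h1]
                gcongr
          _ = ‖A‖ * Cq * (1 + ‖x‖) ^ (-((D : ℝ) + 1)) * ((1 + ‖x‖) ^ P * Real.exp (-m * ‖x‖ ^ 2)) := by rw [h3]; ring
          _ ≤ ‖A‖ * Cq * (1 + ‖x‖) ^ (-((D : ℝ) + 1)) * Real.exp (P ^ 2 / (4 * m)) := by gcongr
          _ = Cfin * (1 + ‖x‖) ^ (-((D : ℝ) + 1)) := by rw [hCfin]; ring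
    have hB₀A : Integrable (fun y : Fin 1 → (mixedSpace K)ˣ => B₀ ((y 0 : (mixedSpace K)ˣ) : mixedSpace K)) μA := by
      have h := (integrable_map_equiv eU (fun c : (mixedSpace K)ˣ => B₀ (c : mixedSpace K))).mp hB₀int
      exact h
    have hBprod : Integrable (fun p : (Fin 1 → (mixedSpace K)ˣ) × ↥(Kinf 1 K) =>
        B₀ ((p.1 0 : (mixedSpace K)ˣ) : mixedSpace K)) (μA.prod μK) := by
      have h := hB₀A.mul_prod (integrable_const (μ := μK) (1 : ℝ))
      simpa using h
    refine Integrable.mono' hBprod hcont.aestronglyMeasurable (Filter.Eventually.of_forall fun p => ?_)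
    -- the pointwise bound
    set g : GL (Fin 1) (mixedSpace K) := glDiagonal 1 (mixedSpace K) p.1 * (p.2 : GL (Fin 1) (mixedSpace K)) with hg
    have hdet : Matrix.GeneralLinearGroup.det g = p.1 0 * Matrix.GeneralLinearGroup.det (p.2 : GL (Fin 1) (mixedSpace K)) :=
      det_glDiagonal_one_mul p.1 _
    have hNpos : 0 < mixedEmbedding.norm ((p.1 0 : (mixedSpace K)ˣ) : mixedSpace K) := mixedEmbedding_norm_units_pos _
    have hnormc : ‖((Matrix.GeneralLinearGroup.det g : (mixedSpace K)ˣ) : mixedSpace K)‖ = ‖((p.1 0 : (mixedSpace K)ˣ) : mixedSpace K)‖ := by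
      rw [hdet, Units.val_mul]
      exact norm_mul_eq_of_unimodular (abs_fst_det_eq_one_of_mem_Kinf p.2) (norm_snd_det_eq_one_of_mem_Kinf p.2)
    have hΨb := hbound (fun _ : Fin 1 => ((Matrix.GeneralLinearGroup.det g : (mixedSpace K)ˣ) : mixedSpace K))
    rw [pi_norm_const, hnormc] at hΨb
    rw [norm_mul, norm_mul, norm_mul, hη1, one_mul, Complex.norm_cpow_eq_rpow_re_of_pos hNpos]
    simp only [B₀]
    have hA0 : 0 ≤ ‖A‖ := norm_nonneg _
    calc ‖A‖ * (‖Ψt ((Matrix.GeneralLinearGroup.det g : (mixedSpace K)ˣ) : mixedSpace K)‖ *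
          mixedEmbedding.norm ((p.1 0 : (mixedSpace K)ˣ) : mixedSpace K) ^ s.re)
        ≤ ‖A‖ * ((Cq * (1 + ‖((p.1 0 : (mixedSpace K)ˣ) : mixedSpace K)‖) ^ kq *
            Real.exp (-m * ‖((p.1 0 : (mixedSpace K)ˣ) : mixedSpace K)‖ ^ 2)) *
          mixedEmbedding.norm ((p.1 0 : (mixedSpace K)ˣ) : mixedSpace K) ^ s.re) := by gcongr
      _ = ‖A‖ * Cq * (1 + ‖((p.1 0 : (mixedSpace K)ˣ) : mixedSpace K)‖) ^ kq *
          Real.exp (-m * ‖((p.1 0 : (mixedSpace K)ˣ) : mixedSpace K)‖ ^ 2) *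
          mixedEmbedding.norm ((p.1 0 : (mixedSpace K)ˣ) : mixedSpace K) ^ σ := by rw [hσ]; ring

end Main

end Literature.NumberTheory.Automorphic
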